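import Mathlib
import HarnessLib
import Summits.HubbardSuperconductivity.HubbardSuperconductivity.Theorems.KLProgrammeKLRegimeWickCrossContractionGramHybridEngine

/-!
# Route `KLProgramme` — ENGINE child gen 8 (stmt-HubbardSuperconductivity-20437 `KLRegimeEngineV17F2`), stub (c) v2 class #3 (E.5 share), PROVING side:
# the ASSEMBLED line-number tail of the two-vertex term in HYBRID form (output labels prescribed, output positions summed, one pinned), both pinnings
# (cell gate-hubbard-kl, seat p5 g8; sequel to `…GramHybrid` / `…GramHybridEngine`; cure of FINDING (E5-VOL))

The HYBRID twin of `…GramTailNorm` (p549430) / `…GramTailValue` (p532413) for the CONTINUOUS source (weight `((k−1)!)⁻¹`; the E.5 block is re-indexed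
`k = i + 1` by its consumer): for the two-symbol line family (line `0` of symbol `s₀` with row/column sums `≤ α`, `e'` explicit lines of symbol `s₁` with
entries `≤ δ`, Gram constants `κ` per symbol), a colouring `s` with `m₀` legs from `a` / `m₁` from `b`, one output leg `p` pinned at `z` and EVERY output label
prescribed (`Ωo`): `Σ_{k=e'+1}^{Nmax} ((k−1)!)⁻¹ · Σ_{Z : Z p = z, (Z j).2 = Ωo j} ‖kernel(Π_k(Ga′⁰Gb′¹)) m (Z,s)‖ ≤ ((m₀+m₁+(e'+1)+1)!/(m!(1−x)^{m₀+m₁+(e'+1)+2}))·(α·(δ·4ρ₀)^{e'}·A)`,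
given per-`k` LEVELLED vertex sizes at EXACTLY the value-form prescriptions and ONE envelope `(Σ_tκ_t²)^{k−e'−1}·(εNa k)(εNb k) ≤ x^{k−e'−1}·A`;
`…_mul` pins an output leg of `Ga` (`s p = 0`), `…_mul_of_b` one of `Gb` (`s p = 1`).

`Nmax`-uniform.  Bookkeeping over landed theorems; no definitions, no named facts, nothing about the model's sizes is asserted; nothing asserts superconductivity.
-/

noncomputable section

namespace Summit.HubbardSuperconductivity.HubbardSuperconductivity.Theorems.KLRegimeWick

set_option linter.dupNamespace false -- summit = problem name (single-conjunct summit), D-0017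

open Literature.MathematicalPhysics.QuantumLattice Literature.Probability.LatticeModels GrassmannAlgebra Finset Matrix Nat
open Summit.HubbardSuperconductivity.HubbardSuperconductivity.Theorems.KLRegimeSplit
open scoped InnerProductSpace

/-! ## §1 The real core of the tail (weight `((k−1)!)⁻¹`, as in `…GramTailNorm`, levels `a = m₀`, `b = m₁`) -/

section Core

/-- Core, weight `((k−1)!)⁻¹` (`1 ≤ e`). -/
private theorem tailHybrid_core_mul {e m a b Nmax : ℕ} (he : 1 ≤ e) (B : ℕ → ℝ) (hB0 : ∀ k, 0 ≤ B k) {X P : ℝ} (hP : 0 ≤ P) (Na Nb : ℕ → ℝ)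
    {x A : ℝ} (hx0 : 0 ≤ x) (hx1 : x < 1) (hA : 0 ≤ A)
    (hB : ∀ k ∈ Icc e Nmax, B k ≤ ((k + a)! * (k + b)! : ℝ) / (m ! * (k - e)!) * X ^ (k - e) * (P * Na k * Nb k))
    (henv : ∀ k ∈ Icc e Nmax, X ^ (k - e) * (Na k * Nb k) ≤ x ^ (k - e) * A) :
    ∑ k ∈ Icc e Nmax, ((k - 1)! : ℝ)⁻¹ * B k ≤ ((a + b + e + 1)! : ℝ) / (m ! * (1 - x) ^ (a + b + e + 2)) * (P * A) := by
  have h := klgt_norm_sum_le_of_tail_mul (E := ℝ) (fun k => ((k - 1)! : ℝ)⁻¹ * B k) hx0 hx1 (mul_nonneg hP hA) a b e m Nmax fun k hk => ?_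
  · refine le_trans (le_of_eq ?_) h
    rw [Real.norm_of_nonneg (sum_nonneg fun k _ => mul_nonneg (inv_nonneg.2 (by positivity)) (hB0 k))]
  · rw [Real.norm_of_nonneg (mul_nonneg (inv_nonneg.2 (by positivity)) (hB0 k))]
    have hk1 : 1 ≤ k := he.trans (mem_Icc.1 hk).1
    have hk0 : (0 : ℝ) < (k - 1)! := by positivity
    have hK : (0 : ℝ) ≤ (k : ℝ) * (((k + a)! * (k + b)! : ℝ) / (k ! * m ! * (k - e)!)) * P := by positivity
    calc ((k - 1)! : ℝ)⁻¹ * B k ≤ ((k - 1)! : ℝ)⁻¹ * (((k + a)! * (k + b)! : ℝ) / (m ! * (k - e)!) * X ^ (k - e) * (P * Na k * Nb k)) :=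
          mul_le_mul_of_nonneg_left (hB k hk) (inv_nonneg.2 hk0.le)
      _ = ((k + a)! * (k + b)! : ℝ) / ((k - 1)! * m ! * (k - e)!) * P * (X ^ (k - e) * (Na k * Nb k)) := by
          rw [div_eq_mul_inv, div_eq_mul_inv, mul_inv, mul_inv, mul_inv]
          ring
      _ = (k : ℝ) * (((k + a)! * (k + b)! : ℝ) / (k ! * m ! * (k - e)!)) * P * (X ^ (k - e) * (Na k * Nb k)) := by
          rw [klgt_coeff_pred_factorial_eq hk1]
      _ ≤ (k : ℝ) * (((k + a)! * (k + b)! : ℝ) / (k ! * m ! * (k - e)!)) * P * (x ^ (k - e) * A) := mul_le_mul_of_nonneg_left (henv k hk) hK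
      _ = (k : ℝ) * (((k + a)! * (k + b)! : ℝ) / (k ! * m ! * (k - e)!)) * x ^ (k - e) * (P * A) := by ring

end Core

section Assignment

variable {ι : Type*}

/-- The two-symbol assignment reads `s₀` on line `0`. -/
private theorem iteH_castLE_zero {k e' : ℕ} (he : e' + 1 ≤ k) (s₀ s₁ : ι) :
    (if ((Fin.castLE he 0 : Fin k) : ℕ) = 0 then s₀ else s₁) = s₀ := by
  rw [Fin.val_castLE, Fin.val_zero, if_pos rfl]

/-- The two-symbol assignment reads `s₁` on the lines `i.succ`. -/
private theorem iteH_castLE_succ {k e' : ℕ} (he : e' + 1 ≤ k) (s₀ s₁ : ι) (i : Fin e') :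
    (if ((Fin.castLE he i.succ : Fin k) : ℕ) = 0 then s₀ else s₁) = s₁ := by
  rw [Fin.val_castLE, Fin.val_succ, if_neg (Nat.succ_ne_zero _)]

end Assignment

/-! ## §2 The per-`k` bridges for the two-symbol family and the assembled HYBRID tails, engine currency -/

section Tail

variable {L M N : ℕ} [NeZero L] {ι : Type*} [Fintype ι] [DecidableEq ι]

/-- The per-`k` HYBRID bound for the two-symbol line family (line `0` of symbol `s₀`, the `e'` explicit lines of symbol `s₁`), sizes `Na`, `Nb` uniform
over the prescriptions. [cite: BenfattoGiulianiMastropietro2006, §2.8 (2.80)] -/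
theorem sum_norm_kernel_crossContract_sectorPreimage_le_gramF_two_labels {k e' m m₀ m₁ : ℕ} (he : e' + 1 ≤ k) {β : ℝ} (hβ : 0 ≤ β)
    (F Ft : Fin N → FreqMomentum L M → ℂ)
    {ρ₀ : ℕ} (hρ₀ : ∀ ω : Fin N, ((univ : Finset (Fin N)).filter fun ω' => ∃ q, Ft ω q * Ft ω' q ≠ 0).card ≤ ρ₀)
    (sym : ι → FreqMomentum L M × Fin 2 → ℂ) (s₀ s₁ : ι) (κ : ι → ℝ)
    (hκF : ∀ (t : ι) (Y : SpaceTimeIdx L M × SectorLeg N), Y.2.2 = 0 → ‖sectorGramF L M β Ft (sym t) Y‖ ≤ κ t)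
    (hκG : ∀ (t : ι) (Y : SpaceTimeIdx L M × SectorLeg N), Y.2.2 = 1 → ‖sectorGramG L M β Ft (sym t) Y‖ ≤ κ t)
    (Ga Gb : HubbardGrassmann L M) (s : Fin m → Fin 2)
    (hm₀ : (univ.filter fun i => s i = 0).card = m₀) (hm₁ : (univ.filter fun i => s i = 1).card = m₁) (p : Fin m) (hp : s p = 0)
    (z : SpaceTimeIdx L M × SectorLeg N) (Ωo : Fin m → SectorLeg N) {α : ℝ}
    (hrow : ∀ X, ∑ Y, ‖((sectorSubMatrix L M β Ft).transpose * normalCovariance L M (sym s₀) * sectorSubMatrix L M β Ft) X Y‖ ≤ α)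
    (hcol : ∀ Y, ∑ X, ‖((sectorSubMatrix L M β Ft).transpose * normalCovariance L M (sym s₀) * sectorSubMatrix L M β Ft) X Y‖ ≤ α)
    {δ : ℝ} (hδ : 0 ≤ δ) (hent : ∀ X Y, ‖((sectorSubMatrix L M β Ft).transpose * normalCovariance L M (sym s₁) * sectorSubMatrix L M β Ft) X Y‖ ≤ δ)
    {Na Nb : ℝ} (hNb0 : 0 ≤ Nb)
    (hNa : ∀ σ₀ : Fin m₀ → SectorLeg N, hubbardSectorKernelNorm L M β F (prescribedTuples univ
      (Fin.append (fun _ : Fin k => (none : Option (SectorLeg N))) (fun j => some (σ₀ j)))) Ga ≤ Na)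
    (hNb : ∀ (ω₀ : SectorLeg N) (τ' : Fin e' → SectorLeg N) (σ₁ : Fin m₁ → SectorLeg N), hubbardSectorKernelNorm L M β F (prescribedTuples univ
      (Fin.append (fun i : Fin k => if h : (i : ℕ) < e' + 1 then
        (Fin.cons (some ω₀) (fun j => some (τ' j)) : Fin (e' + 1) → Option (SectorLeg N)) ⟨i, h⟩ else none) (fun j => some (σ₁ j)))) Gb ≤ Nb) :
    ∑ Z ∈ univ.filter (fun Z : Fin m → SpaceTimeIdx L M × SectorLeg N => Z p = z ∧ ∀ j, (Z j).2 = Ωo j),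
        ‖kernel ℂ (((List.ofFn fun i : Fin k => grassmannLaplacian ℂ (crossCov ℂ
            ((sectorSubMatrix L M β Ft).transpose * normalCovariance L M (sym (if (i : ℕ) = 0 then s₀ else s₁)) * sectorSubMatrix L M β Ft))).reverse).prod
          (dblCopy ℂ 0 (sectorPreimage β F Ga) * dblCopy ℂ 1 (sectorPreimage β F Gb))) m (fun i => (Z i, s i))‖ ≤
      (((k + m₀).factorial * (k + m₁).factorial : ℝ) / (m.factorial * (k - (e' + 1)).factorial)) * (∑ t, κ t ^ 2) ^ (k - (e' + 1)) *
        (α * (δ * ((4 * ρ₀ : ℕ) : ℝ)) ^ e' * (imagTimeWeight β M * Na) * (imagTimeWeight β M * Nb)) := by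
  have h := sum_norm_kernel_crossContract_sectorPreimage_le_gramF_labels (ι := ι) he hβ F Ft hρ₀ sym (fun i : Fin k => if (i : ℕ) = 0 then s₀ else s₁)
    κ hκF hκG Ga Gb s hm₀ hm₁ p hp z Ωo (by rw [iteH_castLE_zero he]; exact hrow) (by rw [iteH_castLE_zero he]; exact hcol) (fun _ : Fin e' => δ)
    (fun _ => hδ) (fun i X Y => by rw [iteH_castLE_succ he]; exact hent X Y) hNb0 hNa hNb
  rw [prod_const, Finset.card_univ, Fintype.card_fin] at h
  exact h

/-- The per-`k` HYBRID bound for the two-symbol line family, pinned at an output leg of `Gb` (roles exchanged), sizes `Na`, `Nb` uniform over the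
prescriptions. [cite: BenfattoGiulianiMastropietro2006, §2.8 (2.80)] -/
theorem sum_norm_kernel_crossContract_sectorPreimage_le_gramF_two_labels_of_b {k e' m m₀ m₁ : ℕ} (he : e' + 1 ≤ k) {β : ℝ} (hβ : 0 ≤ β)
    (F Ft : Fin N → FreqMomentum L M → ℂ)
    {ρ₀ : ℕ} (hρ₀ : ∀ ω : Fin N, ((univ : Finset (Fin N)).filter fun ω' => ∃ q, Ft ω q * Ft ω' q ≠ 0).card ≤ ρ₀)
    (sym : ι → FreqMomentum L M × Fin 2 → ℂ) (s₀ s₁ : ι) (κ : ι → ℝ)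
    (hκF : ∀ (t : ι) (Y : SpaceTimeIdx L M × SectorLeg N), Y.2.2 = 0 → ‖sectorGramF L M β Ft (sym t) Y‖ ≤ κ t)
    (hκG : ∀ (t : ι) (Y : SpaceTimeIdx L M × SectorLeg N), Y.2.2 = 1 → ‖sectorGramG L M β Ft (sym t) Y‖ ≤ κ t)
    (Ga Gb : HubbardGrassmann L M) (s : Fin m → Fin 2)
    (hm₀ : (univ.filter fun i => s i = 0).card = m₀) (hm₁ : (univ.filter fun i => s i = 1).card = m₁) (p : Fin m) (hp : s p = 1)
    (z : SpaceTimeIdx L M × SectorLeg N) (Ωo : Fin m → SectorLeg N) {α : ℝ}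
    (hrow : ∀ X, ∑ Y, ‖((sectorSubMatrix L M β Ft).transpose * normalCovariance L M (sym s₀) * sectorSubMatrix L M β Ft) X Y‖ ≤ α)
    (hcol : ∀ Y, ∑ X, ‖((sectorSubMatrix L M β Ft).transpose * normalCovariance L M (sym s₀) * sectorSubMatrix L M β Ft) X Y‖ ≤ α)
    {δ : ℝ} (hδ : 0 ≤ δ) (hent : ∀ X Y, ‖((sectorSubMatrix L M β Ft).transpose * normalCovariance L M (sym s₁) * sectorSubMatrix L M β Ft) X Y‖ ≤ δ)
    {Na Nb : ℝ} (hNa0 : 0 ≤ Na)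
    (hNa : ∀ (ω₀ : SectorLeg N) (τ' : Fin e' → SectorLeg N) (σ₀ : Fin m₀ → SectorLeg N), hubbardSectorKernelNorm L M β F (prescribedTuples univ
      (Fin.append (fun i : Fin k => if h : (i : ℕ) < e' + 1 then
        (Fin.cons (some ω₀) (fun j => some (τ' j)) : Fin (e' + 1) → Option (SectorLeg N)) ⟨i, h⟩ else none) (fun j => some (σ₀ j)))) Ga ≤ Na)
    (hNb : ∀ σ₁ : Fin m₁ → SectorLeg N, hubbardSectorKernelNorm L M β F (prescribedTuples univ
      (Fin.append (fun _ : Fin k => (none : Option (SectorLeg N))) (fun j => some (σ₁ j)))) Gb ≤ Nb) :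
    ∑ Z ∈ univ.filter (fun Z : Fin m → SpaceTimeIdx L M × SectorLeg N => Z p = z ∧ ∀ j, (Z j).2 = Ωo j),
        ‖kernel ℂ (((List.ofFn fun i : Fin k => grassmannLaplacian ℂ (crossCov ℂ
            ((sectorSubMatrix L M β Ft).transpose * normalCovariance L M (sym (if (i : ℕ) = 0 then s₀ else s₁)) * sectorSubMatrix L M β Ft))).reverse).prod
          (dblCopy ℂ 0 (sectorPreimage β F Ga) * dblCopy ℂ 1 (sectorPreimage β F Gb))) m (fun i => (Z i, s i))‖ ≤
      (((k + m₀).factorial * (k + m₁).factorial : ℝ) / (m.factorial * (k - (e' + 1)).factorial)) * (∑ t, κ t ^ 2) ^ (k - (e' + 1)) *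
        (α * (δ * ((4 * ρ₀ : ℕ) : ℝ)) ^ e' * (imagTimeWeight β M * Na) * (imagTimeWeight β M * Nb)) := by
  have h := sum_norm_kernel_crossContract_sectorPreimage_le_gramF_labels_of_b (ι := ι) he hβ F Ft hρ₀ sym (fun i : Fin k => if (i : ℕ) = 0 then s₀ else s₁)
    κ hκF hκG Ga Gb s hm₀ hm₁ p hp z Ωo (by rw [iteH_castLE_zero he]; exact hrow) (by rw [iteH_castLE_zero he]; exact hcol) (fun _ : Fin e' => δ)
    (fun _ => hδ) (fun i X Y => by rw [iteH_castLE_succ he]; exact hent X Y) hNa0 hNa hNb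
  rw [prod_const, Finset.card_univ, Fintype.card_fin] at h
  exact h

/-- **The assembled line-number tail, HYBRID form, weight `((k−1)!)⁻¹`** (continuous source): `≤ ((m₀+m₁+(e'+1)+1)!/(m!(1−x)^{m₀+m₁+(e'+1)+2}))·(α·(δ·4ρ₀)^{e'}·A)`.
[cite: BenfattoGiulianiMastropietro2006, §2.8 (2.80)] -/
theorem sum_norm_kernel_crossContract_sectorPreimage_le_gramTailHybrid_mul {e' m m₀ m₁ Nmax : ℕ} {β : ℝ} (hβ : 0 ≤ β)
    (F Ft : Fin N → FreqMomentum L M → ℂ)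
    {ρ₀ : ℕ} (hρ₀ : ∀ ω : Fin N, ((univ : Finset (Fin N)).filter fun ω' => ∃ q, Ft ω q * Ft ω' q ≠ 0).card ≤ ρ₀)
    (sym : ι → FreqMomentum L M × Fin 2 → ℂ) (s₀ s₁ : ι) (κ : ι → ℝ)
    (hκF : ∀ (t : ι) (Y : SpaceTimeIdx L M × SectorLeg N), Y.2.2 = 0 → ‖sectorGramF L M β Ft (sym t) Y‖ ≤ κ t)
    (hκG : ∀ (t : ι) (Y : SpaceTimeIdx L M × SectorLeg N), Y.2.2 = 1 → ‖sectorGramG L M β Ft (sym t) Y‖ ≤ κ t)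
    (Ga Gb : HubbardGrassmann L M) (s : Fin m → Fin 2)
    (hm₀ : (univ.filter fun i => s i = 0).card = m₀) (hm₁ : (univ.filter fun i => s i = 1).card = m₁) (p : Fin m) (hp : s p = 0)
    (z : SpaceTimeIdx L M × SectorLeg N) (Ωo : Fin m → SectorLeg N) {α : ℝ} (hα : 0 ≤ α)
    (hrow : ∀ X, ∑ Y, ‖((sectorSubMatrix L M β Ft).transpose * normalCovariance L M (sym s₀) * sectorSubMatrix L M β Ft) X Y‖ ≤ α)
    (hcol : ∀ Y, ∑ X, ‖((sectorSubMatrix L M β Ft).transpose * normalCovariance L M (sym s₀) * sectorSubMatrix L M β Ft) X Y‖ ≤ α)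
    {δ : ℝ} (hδ : 0 ≤ δ) (hent : ∀ X Y, ‖((sectorSubMatrix L M β Ft).transpose * normalCovariance L M (sym s₁) * sectorSubMatrix L M β Ft) X Y‖ ≤ δ)
    (Na Nb : ℕ → ℝ) (hNb0 : ∀ k, 0 ≤ Nb k)
    (hNa : ∀ k ∈ Icc (e' + 1) Nmax, ∀ σ₀ : Fin m₀ → SectorLeg N, hubbardSectorKernelNorm L M β F (prescribedTuples univ
      (Fin.append (fun _ : Fin k => (none : Option (SectorLeg N))) (fun j => some (σ₀ j)))) Ga ≤ Na k)
    (hNb : ∀ k ∈ Icc (e' + 1) Nmax, ∀ (ω₀ : SectorLeg N) (τ' : Fin e' → SectorLeg N) (σ₁ : Fin m₁ → SectorLeg N),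
      hubbardSectorKernelNorm L M β F (prescribedTuples univ
        (Fin.append (fun i : Fin k => if h : (i : ℕ) < e' + 1 then
          (Fin.cons (some ω₀) (fun j => some (τ' j)) : Fin (e' + 1) → Option (SectorLeg N)) ⟨i, h⟩ else none) (fun j => some (σ₁ j)))) Gb ≤ Nb k)
    {x A : ℝ} (hx0 : 0 ≤ x) (hx1 : x < 1) (hA : 0 ≤ A)
    (henv : ∀ k ∈ Icc (e' + 1) Nmax,
      (∑ t, κ t ^ 2) ^ (k - (e' + 1)) * ((imagTimeWeight β M * Na k) * (imagTimeWeight β M * Nb k)) ≤ x ^ (k - (e' + 1)) * A) :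
    ∑ k ∈ Icc (e' + 1) Nmax, ((k - 1)! : ℝ)⁻¹ *
      ∑ Z ∈ univ.filter (fun Z : Fin m → SpaceTimeIdx L M × SectorLeg N => Z p = z ∧ ∀ j, (Z j).2 = Ωo j),
        ‖kernel ℂ (((List.ofFn fun i : Fin k => grassmannLaplacian ℂ (crossCov ℂ
            ((sectorSubMatrix L M β Ft).transpose * normalCovariance L M (sym (if (i : ℕ) = 0 then s₀ else s₁)) * sectorSubMatrix L M β Ft))).reverse).prod
          (dblCopy ℂ 0 (sectorPreimage β F Ga) * dblCopy ℂ 1 (sectorPreimage β F Gb))) m (fun i => (Z i, s i))‖ ≤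
      ((m₀ + m₁ + (e' + 1) + 1)! : ℝ) / (m ! * (1 - x) ^ (m₀ + m₁ + (e' + 1) + 2)) * (α * (δ * ((4 * ρ₀ : ℕ) : ℝ)) ^ e' * A) := by
  refine tailHybrid_core_mul (Nat.succ_le_succ (Nat.zero_le e')) _ (fun k => sum_nonneg fun _ _ => norm_nonneg _)
    (by positivity : (0 : ℝ) ≤ α * (δ * ((4 * ρ₀ : ℕ) : ℝ)) ^ e')
    (fun k => imagTimeWeight β M * Na k) (fun k => imagTimeWeight β M * Nb k) hx0 hx1 hA (fun k hk => ?_) henv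
  have hek : e' + 1 ≤ k := (mem_Icc.1 hk).1
  refine (sum_norm_kernel_crossContract_sectorPreimage_le_gramF_two_labels hek hβ F Ft hρ₀ sym s₀ s₁ κ hκF hκG Ga Gb s hm₀ hm₁ p hp z Ωo hrow hcol
    hδ hent (hNb0 k) (hNa k hk) (hNb k hk)).trans (le_of_eq ?_)
  ring

/-- **The assembled line-number tail, HYBRID form, weight `((k−1)!)⁻¹`, pinned at an output leg of `Gb`** (roles exchanged): `≤ ((m₀+m₁+(e'+1)+1)!/(m!(1−x)^{m₀+m₁+(e'+1)+2}))·(α·(δ·4ρ₀)^{e'}·A)`.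
[cite: BenfattoGiulianiMastropietro2006, §2.8 (2.80)] -/
theorem sum_norm_kernel_crossContract_sectorPreimage_le_gramTailHybrid_mul_of_b {e' m m₀ m₁ Nmax : ℕ} {β : ℝ} (hβ : 0 ≤ β)
    (F Ft : Fin N → FreqMomentum L M → ℂ)
    {ρ₀ : ℕ} (hρ₀ : ∀ ω : Fin N, ((univ : Finset (Fin N)).filter fun ω' => ∃ q, Ft ω q * Ft ω' q ≠ 0).card ≤ ρ₀)
    (sym : ι → FreqMomentum L M × Fin 2 → ℂ) (s₀ s₁ : ι) (κ : ι → ℝ)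
    (hκF : ∀ (t : ι) (Y : SpaceTimeIdx L M × SectorLeg N), Y.2.2 = 0 → ‖sectorGramF L M β Ft (sym t) Y‖ ≤ κ t)
    (hκG : ∀ (t : ι) (Y : SpaceTimeIdx L M × SectorLeg N), Y.2.2 = 1 → ‖sectorGramG L M β Ft (sym t) Y‖ ≤ κ t)
    (Ga Gb : HubbardGrassmann L M) (s : Fin m → Fin 2)
    (hm₀ : (univ.filter fun i => s i = 0).card = m₀) (hm₁ : (univ.filter fun i => s i = 1).card = m₁) (p : Fin m) (hp : s p = 1)
    (z : SpaceTimeIdx L M × SectorLeg N) (Ωo : Fin m → SectorLeg N) {α : ℝ} (hα : 0 ≤ α)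
    (hrow : ∀ X, ∑ Y, ‖((sectorSubMatrix L M β Ft).transpose * normalCovariance L M (sym s₀) * sectorSubMatrix L M β Ft) X Y‖ ≤ α)
    (hcol : ∀ Y, ∑ X, ‖((sectorSubMatrix L M β Ft).transpose * normalCovariance L M (sym s₀) * sectorSubMatrix L M β Ft) X Y‖ ≤ α)
    {δ : ℝ} (hδ : 0 ≤ δ) (hent : ∀ X Y, ‖((sectorSubMatrix L M β Ft).transpose * normalCovariance L M (sym s₁) * sectorSubMatrix L M β Ft) X Y‖ ≤ δ)
    (Na Nb : ℕ → ℝ) (hNa0 : ∀ k, 0 ≤ Na k)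
    (hNa : ∀ k ∈ Icc (e' + 1) Nmax, ∀ (ω₀ : SectorLeg N) (τ' : Fin e' → SectorLeg N) (σ₀ : Fin m₀ → SectorLeg N),
      hubbardSectorKernelNorm L M β F (prescribedTuples univ
        (Fin.append (fun i : Fin k => if h : (i : ℕ) < e' + 1 then
          (Fin.cons (some ω₀) (fun j => some (τ' j)) : Fin (e' + 1) → Option (SectorLeg N)) ⟨i, h⟩ else none) (fun j => some (σ₀ j)))) Ga ≤ Na k)
    (hNb : ∀ k ∈ Icc (e' + 1) Nmax, ∀ σ₁ : Fin m₁ → SectorLeg N, hubbardSectorKernelNorm L M β F (prescribedTuples univ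
      (Fin.append (fun _ : Fin k => (none : Option (SectorLeg N))) (fun j => some (σ₁ j)))) Gb ≤ Nb k)
    {x A : ℝ} (hx0 : 0 ≤ x) (hx1 : x < 1) (hA : 0 ≤ A)
    (henv : ∀ k ∈ Icc (e' + 1) Nmax,
      (∑ t, κ t ^ 2) ^ (k - (e' + 1)) * ((imagTimeWeight β M * Na k) * (imagTimeWeight β M * Nb k)) ≤ x ^ (k - (e' + 1)) * A) :
    ∑ k ∈ Icc (e' + 1) Nmax, ((k - 1)! : ℝ)⁻¹ *
      ∑ Z ∈ univ.filter (fun Z : Fin m → SpaceTimeIdx L M × SectorLeg N => Z p = z ∧ ∀ j, (Z j).2 = Ωo j),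
        ‖kernel ℂ (((List.ofFn fun i : Fin k => grassmannLaplacian ℂ (crossCov ℂ
            ((sectorSubMatrix L M β Ft).transpose * normalCovariance L M (sym (if (i : ℕ) = 0 then s₀ else s₁)) * sectorSubMatrix L M β Ft))).reverse).prod
          (dblCopy ℂ 0 (sectorPreimage β F Ga) * dblCopy ℂ 1 (sectorPreimage β F Gb))) m (fun i => (Z i, s i))‖ ≤
      ((m₀ + m₁ + (e' + 1) + 1)! : ℝ) / (m ! * (1 - x) ^ (m₀ + m₁ + (e' + 1) + 2)) * (α * (δ * ((4 * ρ₀ : ℕ) : ℝ)) ^ e' * A) := by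
  refine tailHybrid_core_mul (Nat.succ_le_succ (Nat.zero_le e')) _ (fun k => sum_nonneg fun _ _ => norm_nonneg _)
    (by positivity : (0 : ℝ) ≤ α * (δ * ((4 * ρ₀ : ℕ) : ℝ)) ^ e')
    (fun k => imagTimeWeight β M * Na k) (fun k => imagTimeWeight β M * Nb k) hx0 hx1 hA (fun k hk => ?_) henv
  have hek : e' + 1 ≤ k := (mem_Icc.1 hk).1
  refine (sum_norm_kernel_crossContract_sectorPreimage_le_gramF_two_labels_of_b hek hβ F Ft hρ₀ sym s₀ s₁ κ hκF hκG Ga Gb s hm₀ hm₁ p hp z Ωo hrow hcol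
    hδ hent (hNa0 k) (hNa k hk) (hNb k hk)).trans (le_of_eq ?_)
  ring


end Tail

end Summit.HubbardSuperconductivity.HubbardSuperconductivity.Theorems.KLRegimeWick

end
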